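import Literature.Computability.Complexity.ThresholdPP
import Literature.Computability.Complexity.CountingHierarchyInter
import Literature.Computability.Complexity.FPStringBricks
import Literature.Computability.Complexity.StackWordArith
import Literature.Computability.Complexity.ZIntBricks
import HarnessLib

/-!
# Bounded quantifiers, witness counts and their bits inside the counting hierarchy

Toolkit file (theorems only) for the "scaled-up `FOM`" calculus in which Bürgisser's results on
integers definable in the counting hierarchy are proved (P. Bürgisser, *On defining integers in
the counting hierarchy and proving lower bounds in algebraic complexity*, ECCC TR06-113, §3;
W. Hesse, E. Allender, D. A. M. Barrington, JCSS 65 (2002), §3–4): a language of tuples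
`⟨x, ⟨y, …⟩⟩` (the tree's pairing `boolPair`, read through the total projections `fstP`/`sndP`,
numerals through `bitsToNat`) stays in `CH` under

* polynomially bounded quantifiers over strings and over numbers
  (`exists_mem_CH`, `forall_mem_CH`, `exists_lt_mem_CH`, `forall_lt_mem_CH`) — from
  `∃·CH ⊆ C'·CH ⊆ CH` (`polyExists_subset_pMajority`, `pMajority_CH_subset`) and Gill's
  complementation;
* exact counting of witnesses: for `V ∈ CH` the threshold language
  `TLang V r = {⟨x, ⟨t, ν⟩⟩ | val ν < #{w ∈ {0,1}^{r|x|} | ⟨⟨x,t⟩,w⟩ ∈ V}}` of `ThresholdPP.lean`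
  is in `CH` (`ThresholdPP.TLang_mem_CH`, the same majority vote `majLang` as for `V ∈ P`), hence
  so are the graph `{… | # = val ν}` (`cntV_eq_mem_CH`) and the bit language
  `{⟨x, ⟨t, j⟩⟩ | bit (val j) of # is 1}` (`cntV_testBit_mem_CH`) of the counting function, and
  the untagged forms `cnt_gt_mem_CH`, `cnt_eq_mem_CH`, `cnt_testBit_mem_CH` for
  `#{y ∈ {0,1}^{r|x|} | ⟨x, y⟩ ∈ V}`.

This is the closure of `CH` under the counting quantifier with read-out of the count in binary
(Torán 1991, §4; Bürgisser 2006, §2.1: "functions in `#P` can be evaluated in polynomial time by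
oracle calls to `PP`", relativised), in the operator form the tree uses (`CH = ⋃ₖ CₖP`,
`Cₖ₊₁P = C'·CₖP`). No new definitions; set identities are transported with `mem_CH_of_iff`
(pointwise `↔`, robust to the `Language`/`Set` membership instances).

## References

* J. Torán, *Complexity classes defined by counting quantifiers*, J. ACM 38 (1991) 753–774, §3–4.
* P. Bürgisser, ECCC TR06-113 (2006), §2.1, §3.
* S. Arora, B. Barak, *Computational Complexity* (2009), §17.2.1, proof of Lemma 17.7.
-/

namespace Literature.Computability.Complexity

open _root_.Computability Polynomial PRelSigma TTClosure Brick PPSharpP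

/-! ### Transport of membership in a class along pointwise equivalence -/

/-- Two languages with the same members are equal; membership in `CH` transports. [folklore] -/
theorem mem_CH_of_iff {A : Language Bool} (hA : A ∈ CH) (B : Language Bool)
    (h : ∀ w, w ∈ B ↔ w ∈ A) : B ∈ CH := by
  rwa [← Language.ext h] at hA

/-- The same transport for `P`. [folklore] -/
theorem mem_P_of_iff {A : Language Bool} (hA : A ∈ Classes.P) (B : Language Bool)
    (h : ∀ w, w ∈ B ↔ w ∈ A) : B ∈ Classes.P := by
  rwa [← Language.ext h] at hA

/-! ### Polynomially bounded quantifiers -/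

/-- `CH` is closed under polynomial-time preimages, in the curried form the operator lemmas take. [cite: Toran1991, §3] -/
theorem CH_preimage_closed :
    ∀ ⦃L : Language Bool⦄, L ∈ CH → ∀ ⦃g : List Bool → List Bool⦄, g ∈ FP → g ⁻¹' L ∈ CH :=
  fun _ hL _ hg => preimage_mem_CH hL hg

/-- `∃·CH ⊆ CH`. [cite: Toran1991, §4] -/
theorem polyExists_CH_subset : polyExists CH ⊆ CH :=
  (polyExists_subset_pMajority CH_preimage_closed P_subset_CH).trans pMajority_CH_subset

/-- **Bounded existential quantifier over strings**: for `L ∈ CH` and a polynomial `p`,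
`{x | ∃ y, |y| ≤ p(|x|) ∧ ⟨x, y⟩ ∈ L} ∈ CH`. [cite: Toran1991, §4] -/
theorem exists_mem_CH {L : Language Bool} (hL : L ∈ CH) (p : Polynomial ℕ) :
    {x | ∃ y : List Bool, y.length ≤ p.eval x.length ∧ boolPair x y ∈ L} ∈ CH :=
  polyExists_CH_subset ⟨L, hL, p, fun _ => Iff.rfl⟩

/-- **Bounded universal quantifier over strings**: for `L ∈ CH` and a polynomial `p`,
`{x | ∀ y, |y| ≤ p(|x|) → ⟨x, y⟩ ∈ L} ∈ CH` (complement, `∃`, complement). [cite: Toran1991, §4] -/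
theorem forall_mem_CH {L : Language Bool} (hL : L ∈ CH) (p : Polynomial ℕ) :
    {x | ∀ y : List Bool, y.length ≤ p.eval x.length → boolPair x y ∈ L} ∈ CH := by
  refine mem_CH_of_iff (compl_mem_CH (exists_mem_CH (compl_mem_CH hL) p)) _ fun x => ?_
  rw [memL_compl]
  change _ ↔ ¬ ∃ y : List Bool, y.length ≤ p.eval x.length ∧ boolPair x y ∈ Lᶜ
  simp only [memL_compl, not_exists, not_and, not_not]
  rfl

/-- **Bounded existential quantifier over numbers**: for `L ∈ CH` and a polynomial `p`,
`{x | ∃ v < 2^{p(|x|)}, ⟨x, bin v⟩ ∈ L} ∈ CH` (quantify over strings `y`, `|y| ≤ p(|x|)`, and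
normalise `y ↦ bin (val y)`, a polynomial-time map). [cite: Toran1991, §4] -/
theorem exists_lt_mem_CH {L : Language Bool} (hL : L ∈ CH) (p : Polynomial ℕ) :
    {x | ∃ v < 2 ^ p.eval x.length, boolPair x (encodeNat v) ∈ L} ∈ CH := by
  refine mem_CH_of_iff (exists_mem_CH (preimage_mem_CH hL (mapSndFn_mem_FP norm_mem_FP)) p) _ fun x => ?_
  change (∃ v < 2 ^ p.eval x.length, boolPair x (encodeNat v) ∈ L) ↔
    ∃ y : List Bool, y.length ≤ p.eval x.length ∧ mapSndFn norm (boolPair x y) ∈ L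
  simp only [mapSndFn_boolPair, norm_eq_encodeNat]
  constructor
  · rintro ⟨v, hv, hmem⟩
    exact ⟨encodeNat v, (Brick.length_encodeNat_le_iff v _).2 hv, by rwa [bitsToNat_encodeNat]⟩
  · rintro ⟨y, hy, hmem⟩
    exact ⟨bitsToNat y, (bitsToNat_lt y).trans_le (Nat.pow_le_pow_right (by norm_num) hy), hmem⟩

/-- **Bounded universal quantifier over numbers**: for `L ∈ CH` and a polynomial `p`,
`{x | ∀ v < 2^{p(|x|)}, ⟨x, bin v⟩ ∈ L} ∈ CH`. [cite: Toran1991, §4] -/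
theorem forall_lt_mem_CH {L : Language Bool} (hL : L ∈ CH) (p : Polynomial ℕ) :
    {x | ∀ v < 2 ^ p.eval x.length, boolPair x (encodeNat v) ∈ L} ∈ CH := by
  refine mem_CH_of_iff (compl_mem_CH (exists_lt_mem_CH (compl_mem_CH hL) p)) _ fun x => ?_
  rw [memL_compl]
  change _ ↔ ¬ ∃ v < 2 ^ p.eval x.length, boolPair x (encodeNat v) ∈ Lᶜ
  simp only [memL_compl, not_exists, not_and, not_not]
  rfl

/-! ### Threshold languages of witness counts over `CH` -/

namespace ThresholdPP

variable {V : Language Bool} (r : Polynomial ℕ)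

/-- The witness language of the majority vote stays in `CH` for `V ∈ CH` (it is assembled from
`V` by a polynomial-time preimage and Boolean combinations with `P` languages). [cite: AroraBarak2009, Lemma 17.7 (proof)] -/
theorem majLang_mem_CH (hV : V ∈ CH) : majLang V r ∈ CH := by
  obtain ⟨hx, ht, hν, hr, hw, hp⟩ := accessors_mem_FP (r := r)
  refine union_mem_CH ?_ (P_subset_CH ?_)
  · exact inter_mem_CH (inter_P_mem_CH (preimage_mem_P (HeadIs_mem_P true) sndP_mem_FP)
      (preimage_mem_CH hV (pairFn_mem_FP (pairFn_mem_FP hx ht) hw)))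
      (P_subset_CH (preimage_mem_P (NoBit_mem_P true) hp))
  · exact inter_mem_P (preimage_mem_P (HeadIs_mem_P false) sndP_mem_FP)
      (preimage_mem_P (HeadIs_mem_P false) (comp_mem_FP ltFn_mem_FP (pairFn_mem_FP hr hν)))

/-- **Threshold languages of witness counts over `CH` are in `CH`**: for `V ∈ CH`,
`TLang V r = {⟨x, ⟨t, ν⟩⟩ | val ν < #{w ∈ {0,1}^{r|x|} | ⟨⟨x,t⟩,w⟩ ∈ V}} ∈ C'·CH ⊆ CH`, by the
majority vote of `TLang_mem_PP` verbatim (Torán 1991, §4: the counting quantifier applied to a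
`CH` predicate). [cite: Toran1991, §4] -/
theorem TLang_mem_CH (hV : V ∈ CH) : TLang V r ∈ CH := by
  refine pMajority_CH_subset ⟨majLang V r, majLang_mem_CH r hV, UP r, fun z => ?_⟩
  rw [half_lt_uniformProb_iff, eval_UP]
  have h1 : 2 * (fstP z).length + (sndP z).length ≤ z.length := length_fstF_sndF_le z
  have h2 : 2 * (fstP (sndP z)).length + (sndP (sndP z)).length ≤ (sndP z).length :=
    length_fstF_sndF_le (sndP z)
  have hB1 : r.eval (fstP z).length ≤ r.eval z.length + z.length :=
    (TM2Iter.eval_mono r (by omega)).trans (Nat.le_add_right _ _)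
  have hB2 : (sndP (sndP z)).length ≤ r.eval z.length + z.length := by omega
  rw [cnt_majLang (V := V) (r := r) z hB1]
  have hν : bitsToNat (sndP (sndP z)) ≤ 2 ^ (r.eval z.length + z.length) :=
    (bitsToNat_lt _).le.trans (Nat.pow_le_pow_right two_pos hB2)
  change bitsToNat (sndP (sndP z)) < cntV V r (fstP z) (fstP (sndP z)) ↔ _
  rw [pow_succ]
  omega

/-- The count is at most the number of coin strings: `cntV V r x t ≤ 2^{r|x|}`. [folklore] -/
theorem cntV_le (x t : List Bool) : cntV V r x t ≤ 2 ^ r.eval x.length := by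
  rw [cntV, countWitnesses_eq_cnt]
  exact cnt_le _ _

/-- Membership in `TLang` for an arbitrary string, read through the projections (definitional). [folklore] -/
theorem mem_TLang_iff' (z : List Bool) :
    z ∈ TLang V r ↔ bitsToNat (sndP (sndP z)) < cntV V r (fstP z) (fstP (sndP z)) :=
  Iff.rfl

end ThresholdPP

open ThresholdPP

/-! ### Two polynomial-time atoms: value zero, and a bit of a numeral at a binary address -/

/-- `{w | val w = 0} ∈ P` (normalise and test emptiness). [folklore] -/
theorem valZero_mem_P : ({w | bitsToNat w = 0} : Language Bool) ∈ Classes.P :=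
  mem_P_of_mem_FP (comp_mem_FP isNilFn_mem_FP norm_mem_FP) _ fun w =>
    ⟨fun h => by
      have h' : norm w = [] := (norm_eq_nil_iff w).2 h
      simp [isNilFn, h'],
     fun h => by
      have h' : ¬ norm w = [] := fun h'' => h ((norm_eq_nil_iff w).1 h'')
      simp [isNilFn, h']⟩

/-- The one-bit test "bit `val j` of `val ν`" on `w = ⟨ν, j⟩`: convert `j` to unary capped at
`|ν|`, read the bit there, pad with a `0` (beyond `|ν|` the bit is `0`). [folklore] -/
theorem testBitFn_apply (w : List Bool) :
    (take1Fn ∘ fun z => (bitAtFn ∘ pairFn (binToUnaryFn ∘ pairFn fstP sndP) fstP) z ++ (fun _ => [false]) z) w =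
      [(bitsToNat (fstP w)).testBit (bitsToNat (sndP w))] := by
  simp only [Function.comp_apply, pairFn_apply, binToUnaryFn_boolPair, bitAtFn_boolPair, take1Fn,
    List.length_replicate]
  rw [Com.testBit_bitsToNat]
  by_cases hlt : bitsToNat (sndP w) < (fstP w).length
  · rw [Nat.min_eq_left hlt.le, List.take_one_drop_eq_of_lt_length hlt]
    simp [List.getD_eq_getElem?_getD, List.getElem?_eq_getElem hlt]
  · push Not at hlt
    rw [Nat.min_eq_right hlt, List.drop_of_length_le le_rfl]
    simp [List.getD_eq_getElem?_getD, List.getElem?_eq_none_iff.2 hlt]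

/-- **The bit language of numerals is in `P`**: `{⟨ν, j⟩ | bit (val j) of val ν is 1} ∈ P`. [folklore] -/
theorem testBitLang_mem_P :
    ({w | (bitsToNat (fstP w)).testBit (bitsToNat (sndP w)) = true} : Language Bool) ∈ Classes.P := by
  refine mem_P_of_mem_FP (comp_mem_FP take1Fn_mem_FP (append_mem_FP (comp_mem_FP bitAtFn_mem_FP
      (pairFn_mem_FP (comp_mem_FP binToUnaryFn_mem_FP (pairFn_mem_FP fstP_mem_FP sndP_mem_FP)) fstP_mem_FP))
      (const_mem_FP [false]))) _ fun w => ?_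
  rw [testBitFn_apply]
  constructor
  · intro h
    rw [show (bitsToNat (fstP w)).testBit (bitsToNat (sndP w)) = true from h]
  · intro h
    have h' : ¬ (bitsToNat (fstP w)).testBit (bitsToNat (sndP w)) = true := h
    rw [Bool.not_eq_true] at h'
    rw [h']

/-! ### The graph and the bits of the counting function -/

section Counting

variable {V : Language Bool} (r : Polynomial ℕ)

/-- **The graph of the witness count is in `CH`**: for `V ∈ CH`,
`{⟨x, ⟨t, ν⟩⟩ | #{w ∈ {0,1}^{r|x|} | ⟨⟨x,t⟩,w⟩ ∈ V} = val ν} ∈ CH`, as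
`# = v ↔ ¬ (v < #) ∧ (v = 0 ∨ v - 1 < #)` from the threshold language. [cite: Burgisser2006, §2.1] -/
theorem cntV_eq_mem_CH (hV : V ∈ CH) :
    {z | cntV V r (fstP z) (fstP (sndP z)) = bitsToNat (sndP (sndP z))} ∈ CH := by
  -- `f : ⟨x, ⟨t, ν⟩⟩ ↦ ⟨x, ⟨t, bin (val ν - 1)⟩⟩`
  have hfFP : pairFn fstP (pairFn (fstP ∘ sndP) (subFn ∘ pairFn (sndP ∘ sndP) (fun _ => [true]))) ∈ FP :=
    pairFn_mem_FP fstP_mem_FP (pairFn_mem_FP (comp_mem_FP fstP_mem_FP sndP_mem_FP)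
      (comp_mem_FP subFn_mem_FP (pairFn_mem_FP (comp_mem_FP sndP_mem_FP sndP_mem_FP) (const_mem_FP _))))
  have hZ : ((sndP ∘ sndP) ⁻¹' ({w | bitsToNat w = 0} : Language Bool)) ∈ Classes.P :=
    preimage_mem_P valZero_mem_P (comp_mem_FP sndP_mem_FP sndP_mem_FP)
  refine mem_CH_of_iff (inter_mem_CH (compl_mem_CH (TLang_mem_CH r hV))
    (union_P_mem_CH hZ (preimage_mem_CH (TLang_mem_CH r hV) hfFP))) _ fun z => ?_
  rw [memL_inf', memL_compl, memL_sup, mem_TLang_iff']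
  change _ ↔ _ ∧ (bitsToNat (sndP (sndP z)) = 0 ∨
    pairFn fstP (pairFn (fstP ∘ sndP) (subFn ∘ pairFn (sndP ∘ sndP) (fun _ => [true]))) z ∈ TLang V r)
  simp only [pairFn_apply, Function.comp_apply, mem_TLang_iff, subFn_boolPair, bitsToNat_encodeNat,
    show bitsToNat [true] = 1 from rfl]
  change cntV V r (fstP z) (fstP (sndP z)) = bitsToNat (sndP (sndP z)) ↔ _
  omega

/-- The first component is not longer than the pair. [folklore] -/
theorem length_fstP_le (z : List Bool) : (fstP z).length ≤ z.length := by
  have := length_fstF_sndF_le z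
  change 2 * (fstP z).length + _ ≤ _ at this
  omega

/-- **The bits of the witness count are in `CH`**: for `V ∈ CH`,
`{⟨x, ⟨t, j⟩⟩ | bit (val j) of #{w ∈ {0,1}^{r|x|} | ⟨⟨x,t⟩,w⟩ ∈ V} is 1} ∈ CH`
(`∃ v < 2^{r(n)+1}` with `# = v` and bit `j` of `v` set; Bürgisser 2006, §2.1: "functions in `#P`
can be evaluated in polynomial time by oracle calls to `PP`", relativised to `CH`). [cite: Burgisser2006, §2.1] -/
theorem cntV_testBit_mem_CH (hV : V ∈ CH) :
    {z | (cntV V r (fstP z) (fstP (sndP z))).testBit (bitsToNat (sndP (sndP z))) = true} ∈ CH := by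
  -- `W = {⟨z, ν⟩ | # (x, t) = val ν ∧ bit (val j) of val ν = 1}`, `z = ⟨x, ⟨t, j⟩⟩`
  have hgFP : pairFn (fstP ∘ fstP) (pairFn (fstP ∘ sndP ∘ fstP) sndP) ∈ FP :=
    pairFn_mem_FP (comp_mem_FP fstP_mem_FP fstP_mem_FP)
      (pairFn_mem_FP (comp_mem_FP fstP_mem_FP (comp_mem_FP sndP_mem_FP fstP_mem_FP)) sndP_mem_FP)
  have hT : (pairFn sndP (sndP ∘ sndP ∘ fstP) ⁻¹'
      ({w | (bitsToNat (fstP w)).testBit (bitsToNat (sndP w)) = true} : Language Bool)) ∈ Classes.P :=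
    preimage_mem_P testBitLang_mem_P
      (pairFn_mem_FP sndP_mem_FP (comp_mem_FP sndP_mem_FP (comp_mem_FP sndP_mem_FP fstP_mem_FP)))
  have hW := inter_P_mem_CH hT (preimage_mem_CH (cntV_eq_mem_CH r hV) hgFP)
  refine mem_CH_of_iff (exists_lt_mem_CH hW (r + 1)) _ fun z => ?_
  change _ ↔ ∃ v < 2 ^ (r + 1).eval z.length,
    (bitsToNat (fstP (pairFn sndP (sndP ∘ sndP ∘ fstP) (boolPair z (encodeNat v))))).testBit
        (bitsToNat (sndP (pairFn sndP (sndP ∘ sndP ∘ fstP) (boolPair z (encodeNat v))))) = true ∧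
      cntV V r (fstP (pairFn (fstP ∘ fstP) (pairFn (fstP ∘ sndP ∘ fstP) sndP) (boolPair z (encodeNat v))))
        (fstP (sndP (pairFn (fstP ∘ fstP) (pairFn (fstP ∘ sndP ∘ fstP) sndP) (boolPair z (encodeNat v))))) =
      bitsToNat (sndP (sndP (pairFn (fstP ∘ fstP) (pairFn (fstP ∘ sndP ∘ fstP) sndP) (boolPair z (encodeNat v)))))
  simp only [pairFn_apply, Function.comp_apply, fstP_boolPair, sndP_boolPair, bitsToNat_encodeNat,
    eval_add, eval_one]
  constructor
  · intro hbit
    refine ⟨cntV V r (fstP z) (fstP (sndP z)), ?_, hbit, rfl⟩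
    calc cntV V r (fstP z) (fstP (sndP z)) ≤ 2 ^ r.eval (fstP z).length := cntV_le r _ _
      _ < 2 ^ (r.eval z.length + 1) :=
        Nat.pow_lt_pow_right (by norm_num) (Nat.lt_succ_of_le (TM2Iter.eval_mono r (length_fstP_le z)))
  · rintro ⟨v, -, hbit, hcnt⟩
    change (cntV V r (fstP z) (fstP (sndP z))).testBit (bitsToNat (sndP (sndP z))) = true
    rwa [hcnt]

/-! ### Untagged counts `#{y ∈ {0,1}^{r|x|} | ⟨x, y⟩ ∈ V}` -/

/-- Dropping the tag: with `V' = {⟨⟨x, t⟩, w⟩ | ⟨x, w⟩ ∈ V}` one has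
`cntV V' r x t = #{y ∈ {0,1}^{r|x|} | ⟨x, y⟩ ∈ V}`. [folklore] -/
theorem cntV_untag (V : Language Bool) (x t : List Bool) :
    cntV (pairFn (fstP ∘ fstP) sndP ⁻¹' V) r x t = cnt (r.eval x.length) {y | boolPair x y ∈ V} := by
  rw [cntV, countWitnesses_eq_cnt]
  refine cnt_congr fun y _ => ?_
  change pairFn (fstP ∘ fstP) sndP (boolPair (boolPair x t) y) ∈ V ↔ boolPair x y ∈ V
  simp only [pairFn_apply, Function.comp_apply, fstP_boolPair, sndP_boolPair]

/-- The untagging map `⟨x, ν⟩ ↦ ⟨x, ⟨[], ν⟩⟩` is polynomial-time. [folklore] -/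
theorem untagFn_mem_FP : pairFn fstP (pairFn (fun _ => []) sndP) ∈ FP :=
  pairFn_mem_FP fstP_mem_FP (pairFn_mem_FP (const_mem_FP []) sndP_mem_FP)

/-- `V' = {⟨⟨x, t⟩, w⟩ | ⟨x, w⟩ ∈ V} ∈ CH` for `V ∈ CH`. [folklore] -/
theorem untagWitness_mem_CH (hV : V ∈ CH) : pairFn (fstP ∘ fstP) sndP ⁻¹' V ∈ CH :=
  preimage_mem_CH hV (pairFn_mem_FP (comp_mem_FP fstP_mem_FP fstP_mem_FP) sndP_mem_FP)

/-- **Threshold form, untagged**: for `V ∈ CH`,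
`{⟨x, ν⟩ | val ν < #{y ∈ {0,1}^{r|x|} | ⟨x, y⟩ ∈ V}} ∈ CH`. [cite: Toran1991, §4] -/
theorem cnt_gt_mem_CH (hV : V ∈ CH) :
    {z | bitsToNat (sndP z) < cnt (r.eval (fstP z).length) {y | boolPair (fstP z) y ∈ V}} ∈ CH := by
  refine mem_CH_of_iff (preimage_mem_CH (TLang_mem_CH r (untagWitness_mem_CH hV)) untagFn_mem_FP) _
    fun z => ?_
  change _ ↔ pairFn fstP (pairFn (fun _ => []) sndP) z ∈ TLang (pairFn (fstP ∘ fstP) sndP ⁻¹' V) r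
  rw [pairFn_apply, pairFn_apply, mem_TLang_iff, cntV_untag]
  rfl

/-- **Graph form, untagged**: for `V ∈ CH`,
`{⟨x, ν⟩ | #{y ∈ {0,1}^{r|x|} | ⟨x, y⟩ ∈ V} = val ν} ∈ CH`. [cite: Burgisser2006, §2.1] -/
theorem cnt_eq_mem_CH (hV : V ∈ CH) :
    {z | cnt (r.eval (fstP z).length) {y | boolPair (fstP z) y ∈ V} = bitsToNat (sndP z)} ∈ CH := by
  refine mem_CH_of_iff (preimage_mem_CH (cntV_eq_mem_CH r (untagWitness_mem_CH hV)) untagFn_mem_FP) _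
    fun z => ?_
  change _ ↔ cntV (pairFn (fstP ∘ fstP) sndP ⁻¹' V) r (fstP (pairFn fstP (pairFn (fun _ => []) sndP) z))
      (fstP (sndP (pairFn fstP (pairFn (fun _ => []) sndP) z))) =
    bitsToNat (sndP (sndP (pairFn fstP (pairFn (fun _ => []) sndP) z)))
  simp only [pairFn_apply, fstP_boolPair, sndP_boolPair, cntV_untag]
  rfl

/-- **Bit form, untagged**: for `V ∈ CH`,
`{⟨x, j⟩ | bit (val j) of #{y ∈ {0,1}^{r|x|} | ⟨x, y⟩ ∈ V} is 1} ∈ CH`. [cite: Burgisser2006, §2.1] -/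
theorem cnt_testBit_mem_CH (hV : V ∈ CH) :
    {z | (cnt (r.eval (fstP z).length) {y | boolPair (fstP z) y ∈ V}).testBit (bitsToNat (sndP z)) = true} ∈
      CH := by
  refine mem_CH_of_iff (preimage_mem_CH (cntV_testBit_mem_CH r (untagWitness_mem_CH hV)) untagFn_mem_FP) _
    fun z => ?_
  change _ ↔ (cntV (pairFn (fstP ∘ fstP) sndP ⁻¹' V) r (fstP (pairFn fstP (pairFn (fun _ => []) sndP) z))
      (fstP (sndP (pairFn fstP (pairFn (fun _ => []) sndP) z)))).testBit
    (bitsToNat (sndP (sndP (pairFn fstP (pairFn (fun _ => []) sndP) z)))) = true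
  simp only [pairFn_apply, fstP_boolPair, sndP_boolPair, cntV_untag]
  rfl

end Counting

end Literature.Computability.Complexity
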